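import Mathlib
import Summits.ValiantsHypothesis.ValiantsHypothesis.Theorems.BarrierLeverPartitionMinorsHitByVPHiddenStatesSecondShellNeighbours
import Summits.ValiantsHypothesis.ValiantsHypothesis.Theorems.BarrierLeverPartitionMinorsHitByVPHiddenStatesSecondShellTrappedPlus

/-!
# Route BarrierLever — item `PartitionMinorsHitByVP` (stmt-ValiantsHypothesis-19717), line `hidden-states`:
# ★★ THE UNFED-SET CELL OF THE SECOND SHELL (every `t, h`, every orientation)

Helper file (`--supports stmt-ValiantsHypothesis-19717`; cell valiant-natproofs, 𝒟-side door (c), registered line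
`Cruxes/PartitionMinorsHitByVP/Lines/hidden_states.lean` v9; prover seat val-np-p6 gen 20).  Closes NO item; definition-free.

THE CELL (memo HOME/val-np-p6/g20/MEMO-valnp6-g20.md §3, cells UNF1/UNF2 of the eight-cell decomposition).  A set `F` of coordinates that is
closed under the sources of BOTH transported path tables — for each swap `A_l → C_l` either the whole path `C_l ∖ A_l` lies in `F` or `F`
avoids `A_l △ C_l` (then no edge of that table enters `F`, `…SecondShellNeighbours.tab2_target`) — and that holds MORE TARGETS THAN TOKENS
for one cross minor (`|C₂ ∩ F| < |A₁ ∩ F|` or `|C₁ ∩ F| < |A₂ ∩ F|`) kills that cross minor of the two-parameter table for every parameter by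
the token count `…SecondShellTrappedPlus.det_eq_zero_of_unfed_count`; the exchange composition `…SecondShellCrossTemplate` serves the family.
★★ `exists_table_secondShell_unfed` (general `F`), and the two instances the ∀t theorem uses:
* ★★ `exists_table_secondShell_unfed₁` — the path of swap 1 avoids `A₂ ∪ C₂` and some `x0 ∈ A₁` lies outside `C₁ ∪ A₂ ∪ C₂`
  (`F = (C₁ ∖ A₁) + x0`: one target, no token);
* ★★ `exists_table_secondShell_unfed₂` — the path of swap 2 lies inside `A₁ ∩ C₁` and some `z0 ∈ (A₂ ∖ C₂) ∩ A₁ ∩ C₁`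
  (`F = (C₂ ∖ A₂) + z0`: one more target than tokens).

HONEST LABEL: conjecture-column cells (second shell, every `t, h`); 19717 stays OPEN; nothing on crux 14610 or VP ≠ VNP.
-/

set_option linter.dupNamespace false

namespace Summit.ValiantsHypothesis.ValiantsHypothesis.Theorems.BarrierLever.HiddenStates

open Finset

noncomputable section

namespace SecondShell

open PathTable

/-- ★★ **THE UNFED-SET CELL.**  `F` closed under the sources of both transports (pathwise: the path inside, or `F` off `A_l △ C_l`) and
holding more targets than tokens for one cross minor ⇒ the second-shell family `B_t(h) ∖ {A₁, A₂} ∪ {C₁, C₂}` is served. -/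
theorem exists_table_secondShell_unfed (h t : ℕ) (A₁ A₂ C₁ C₂ : Finset (Fin h))
    (hA₁ : A₁.card = t) (hA₂ : A₂.card = t) (hC₁ : C₁.card = t + 1) (hC₂ : C₂.card = t + 1)
    (h₁ : ¬ A₁ ⊆ C₁) (h₂ : ¬ A₂ ⊆ C₂) (hA : A₁ ≠ A₂) (hC : C₁ ≠ C₂)
    (F : Finset (Fin h))
    (hF₁ : C₁ \ A₁ ⊆ F ∨ ∀ v ∈ F, v ∈ A₁ ↔ v ∈ C₁) (hF₂ : C₂ \ A₂ ⊆ F ∨ ∀ v ∈ F, v ∈ A₂ ↔ v ∈ C₂)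
    (hcount : (C₂ ∩ F).card < (A₁ ∩ F).card ∨ (C₁ ∩ F).card < (A₂ ∩ F).card)
    {r : ℕ} (u cols : Fin r → Finset (Fin h)) (hu : Function.Injective u)
    (hU : ∀ i, ((u i).card ≤ t ∧ u i ≠ A₁ ∧ u i ≠ A₂) ∨ u i = C₁ ∨ u i = C₂)
    (hcols : ∀ J : Finset (Fin h), J.card ≤ t → ∃ kk, cols kk = J) :
    ∃ tx : Option (Fin h) → Fin h → ℂ,
      (Matrix.of fun i kk : Fin r => ∏ a ∈ u i, (tx none a + ∑ q ∈ cols kk, tx (some q) a)).det ≠ 0 := by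
  classical
  obtain ⟨k₁, j₁, j₁', hk₁, hkj₁, a1, a2, a3, a4⟩ := swap_sizes A₁ C₁ hA₁ hC₁ h₁
  obtain ⟨k₂, j₂, j₂', hk₂, hkj₂, b1, b2, b3, b4⟩ := swap_sizes A₂ C₂ hA₂ hC₂ h₂
  obtain ⟨e₁, m1, m2, m3, m4⟩ := exists_equiv_four' A₁ C₁ a1 a2 a3 a4
  obtain ⟨e₂, n1, n2, n3, n4⟩ := exists_equiv_four' A₂ C₂ b1 b2 b3 b4
  refine exists_table_secondShell_of_cross h t A₁ A₂ C₁ C₂ hA₁ hA₂ hC₁ hC₂ hA hC hk₁ hkj₁ hk₂ hkj₂ e₁ m1 m2 m3 m4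
    e₂ n1 n2 n3 n4 u cols hu hU hcols ?_
  -- `F` is closed under the sources of the two-parameter table, for every parameter
  have hclosed : ∀ ε : Fin 2 → ℂ, ∀ a, ∀ q ∈ F,
      tab2 (fun a q => swapTable' e₁ a q - if q = a then 1 else 0)
        (fun a q => swapTable' e₂ a q - if q = a then 1 else 0) ε a q ≠ 0 → a ∈ F := by
    intro ε a q hq hw
    by_cases haq : a = q
    · rw [haq]; exact hq
    rcases tab2_target A₁ C₁ A₂ C₂ e₁ m1 m2 m3 m4 e₂ n1 n2 n3 n4 ε haq hw with ⟨ha, hq'⟩ | ⟨ha, hq'⟩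
    · rcases hF₁ with hsub | hoff
      · exact hsub ha
      · exfalso
        have hiff := hoff q hq
        rcases hq' with hq' | hq' <;> rw [Finset.mem_sdiff] at hq' <;> tauto
    · rcases hF₂ with hsub | hoff
      · exact hsub ha
      · exfalso
        have hiff := hoff q hq
        rcases hq' with hq' | hq' <;> rw [Finset.mem_sdiff] at hq' <;> tauto
  rcases hcount with hc | hc
  · left
    intro rows i₀ hrow₀ key hcolcard ε
    refine det_eq_zero_of_unfed_count _ F (fun a q hq hw => hclosed ε a q hq hw) t rows cols hcolcard i₀ ?_
    intro R hR hRF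
    refine key R hR ?_
    intro hRA
    rw [hRA, hrow₀] at hRF
    omega
  · right
    intro rows i₀ hrow₀ key hcolcard ε
    refine det_eq_zero_of_unfed_count _ F (fun a q hq hw => hclosed ε a q hq hw) t rows cols hcolcard i₀ ?_
    intro R hR hRF
    refine key R hR ?_
    intro hRA
    rw [hRA, hrow₀] at hRF
    omega

/-- ★★ **UNFED CHAIN 1.**  If the path of swap 1 avoids `A₂ ∪ C₂` and some `x0 ∈ A₁` lies outside `C₁ ∪ A₂ ∪ C₂`, the family is served
(the attachment `x0` is a target of `D(A₁ ← C₂)` that no token of `C₂` can reach). -/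
theorem exists_table_secondShell_unfed₁ (h t : ℕ) (A₁ A₂ C₁ C₂ : Finset (Fin h))
    (hA₁ : A₁.card = t) (hA₂ : A₂.card = t) (hC₁ : C₁.card = t + 1) (hC₂ : C₂.card = t + 1)
    (h₁ : ¬ A₁ ⊆ C₁) (h₂ : ¬ A₂ ⊆ C₂) (hA : A₁ ≠ A₂) (hC : C₁ ≠ C₂)
    (hY : ∀ v ∈ C₁ \ A₁, v ∉ A₂ ∧ v ∉ C₂)
    {x0 : Fin h} (hx₁ : x0 ∈ A₁) (hx₂ : x0 ∉ C₁) (hx₃ : x0 ∉ A₂) (hx₄ : x0 ∉ C₂)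
    {r : ℕ} (u cols : Fin r → Finset (Fin h)) (hu : Function.Injective u)
    (hU : ∀ i, ((u i).card ≤ t ∧ u i ≠ A₁ ∧ u i ≠ A₂) ∨ u i = C₁ ∨ u i = C₂)
    (hcols : ∀ J : Finset (Fin h), J.card ≤ t → ∃ kk, cols kk = J) :
    ∃ tx : Option (Fin h) → Fin h → ℂ,
      (Matrix.of fun i kk : Fin r => ∏ a ∈ u i, (tx none a + ∑ q ∈ cols kk, tx (some q) a)).det ≠ 0 := by
  classical
  refine exists_table_secondShell_unfed h t A₁ A₂ C₁ C₂ hA₁ hA₂ hC₁ hC₂ h₁ h₂ hA hC (insert x0 (C₁ \ A₁))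
    (Or.inl (Finset.subset_insert _ _)) (Or.inr ?_) (Or.inl ?_) u cols hu hU hcols
  · intro v hv
    rcases Finset.mem_insert.1 hv with rfl | hv
    · exact ⟨fun h => (hx₃ h).elim, fun h => (hx₄ h).elim⟩
    · have := hY v hv; exact ⟨fun h => (this.1 h).elim, fun h => (this.2 h).elim⟩
  · have h0 : C₂ ∩ insert x0 (C₁ \ A₁) = ∅ := by
      apply Finset.eq_empty_of_forall_notMem
      intro v hv
      rw [Finset.mem_inter, Finset.mem_insert] at hv
      rcases hv.2 with rfl | hv'
      · exact hx₄ hv.1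
      · exact (hY v hv').2 hv.1
    have h1 : x0 ∈ A₁ ∩ insert x0 (C₁ \ A₁) := Finset.mem_inter.2 ⟨hx₁, Finset.mem_insert_self _ _⟩
    rw [h0, Finset.card_empty]
    exact Finset.card_pos.2 ⟨x0, h1⟩

/-- ★★ **UNFED CHAIN 2.**  If the path of swap 2 lies inside `A₁ ∩ C₁` and some attachment `z0 ∈ A₂ ∖ C₂` lies in `A₁ ∩ C₁`, the family
is served (the path of swap 2 carries `|C₂ ∖ A₂|` tokens of `C₂` but, with `z0`, one more target of `A₁`, and nothing enters it). -/
theorem exists_table_secondShell_unfed₂ (h t : ℕ) (A₁ A₂ C₁ C₂ : Finset (Fin h))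
    (hA₁ : A₁.card = t) (hA₂ : A₂.card = t) (hC₁ : C₁.card = t + 1) (hC₂ : C₂.card = t + 1)
    (h₁ : ¬ A₁ ⊆ C₁) (h₂ : ¬ A₂ ⊆ C₂) (hA : A₁ ≠ A₂) (hC : C₁ ≠ C₂)
    (hY : ∀ v ∈ C₂ \ A₂, v ∈ A₁ ∧ v ∈ C₁)
    {z0 : Fin h} (hz₁ : z0 ∈ A₂) (hz₂ : z0 ∉ C₂) (hz₃ : z0 ∈ A₁) (hz₄ : z0 ∈ C₁)
    {r : ℕ} (u cols : Fin r → Finset (Fin h)) (hu : Function.Injective u)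
    (hU : ∀ i, ((u i).card ≤ t ∧ u i ≠ A₁ ∧ u i ≠ A₂) ∨ u i = C₁ ∨ u i = C₂)
    (hcols : ∀ J : Finset (Fin h), J.card ≤ t → ∃ kk, cols kk = J) :
    ∃ tx : Option (Fin h) → Fin h → ℂ,
      (Matrix.of fun i kk : Fin r => ∏ a ∈ u i, (tx none a + ∑ q ∈ cols kk, tx (some q) a)).det ≠ 0 := by
  classical
  refine exists_table_secondShell_unfed h t A₁ A₂ C₁ C₂ hA₁ hA₂ hC₁ hC₂ h₁ h₂ hA hC (insert z0 (C₂ \ A₂))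
    (Or.inr ?_) (Or.inl (Finset.subset_insert _ _)) (Or.inl ?_) u cols hu hU hcols
  · intro v hv
    rcases Finset.mem_insert.1 hv with rfl | hv
    · exact ⟨fun _ => hz₄, fun _ => hz₃⟩
    · have := hY v hv; exact ⟨fun _ => this.2, fun _ => this.1⟩
  · have hz : z0 ∉ C₂ \ A₂ := fun h => hz₂ (Finset.mem_sdiff.1 h).1
    have h0 : C₂ ∩ insert z0 (C₂ \ A₂) = C₂ \ A₂ := by
      ext v
      simp only [Finset.mem_inter, Finset.mem_insert, Finset.mem_sdiff]
      constructor
      · rintro ⟨hvC, rfl | ⟨-, hvA⟩⟩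
        · exact (hz₂ hvC).elim
        · exact ⟨hvC, hvA⟩
      · rintro ⟨hvC, hvA⟩; exact ⟨hvC, Or.inr ⟨hvC, hvA⟩⟩
    have h1 : A₁ ∩ insert z0 (C₂ \ A₂) = insert z0 (C₂ \ A₂) := by
      apply Finset.inter_eq_right.2
      intro v hv
      rcases Finset.mem_insert.1 hv with rfl | hv
      · exact hz₃
      · exact (hY v hv).1
    rw [h0, h1, Finset.card_insert_of_notMem hz]
    omega

end SecondShell

end

end Summit.ValiantsHypothesis.ValiantsHypothesis.Theorems.BarrierLever.HiddenStates
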